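import Mathlib
import HarnessLib
import Summits.HubbardSuperconductivity.HubbardSuperconductivity.Theorems.KLProgrammeKLRegimeEngineTwoLegStepV17F2ClosersPointData
import Summits.HubbardSuperconductivity.HubbardSuperconductivity.Theorems.KLProgrammeKLRegimeEngineTwoLegStepV17F2ClosersQ7U9
import Summits.HubbardSuperconductivity.HubbardSuperconductivity.Theorems.KLProgrammeKLRegimeEngineV8Raise
import Summits.HubbardSuperconductivity.HubbardSuperconductivity.Theorems.KLProgrammeKLRegimeEngineV8DefsU10
import Summits.HubbardSuperconductivity.HubbardSuperconductivity.Theorems.KLProgrammeKLRegimeEngineV8DefsL4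
import Summits.HubbardSuperconductivity.HubbardSuperconductivity.Theorems.KLProgrammeKLRegimeEngineV8DefsG8

/-!
# K3 gen 8, ENGINE child `KLRegimeEngineV17F2` (stmt-HubbardSuperconductivity-20437), stub (e) `stub_twoLeg_step`: the v2 closers RAISE-GENERIC
# (plan g19 (R57b)(ii): «state v2-ready closers for a package `Q` with `(klEngQ7 P R).IsRaiseOf Q`, doors `klEngU₀10`, `klEngL₄`, geometry `klEngGeo8`»)

Cell gate-hubbard-kl, seat hubbard-kl-r2d-p1 (g7).  This lane's (e) shells are `(G, Q)`-generic (`…ClosersGQJ` p546067, `…TwoLegMomentsExport/Raw` p548102/p551320,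
`…ClosersPointData` p552476); here they are instantiated ONCE at the v2 package shape of record: geometry `klEngGeo8` (`klEngGeo8_S` is `rfl`), ANY engine
package `Q` that is a raise of `klEngQ7 P R` (`EngConsts.IsRaiseOf`, …EngineV8Raise p551175 — so `klEngQ8 P R` by `isRaiseOf_klEngQ8` and the 08-29 table's
`klEngQ9 P R` alike; the rows `Q.S' = (klEngQ7 P R).S'`, `Q.CL = …`, are `IsRaiseOf.S'_eq/CL_eq`), the LANDED doors `c ≤ klEngC₃6 P R`, `U ≤ klEngU₀10 P R c`
(`klEngU₀11 ≤ klEngU₀10` will be one `le_trans`), `klEngL₄ P R β U ≤ L`, `klEngM₃ β U L ≤ M`, and a GENERIC reading-jet table `cJ` with `cJ k ≤ klEngGeo7.S k` (token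
#9′ `klC4aJetC2` not yet in the tree; `klC4aJetC_le_klEngGeo7_S` serves `cJ := klC4aJetC` today):

* **`stub_twoLeg_step_of_twoLegDualMomentsAt_raise`** — the (e)-HDUAL text shape: stub (e)'s v2 binders + `hdual : TwoLegDualMomentsAt L M Zt Zs β U μ n`
  + the ALLOWANCE rows `2Zt ≤ 2^10e¹⁸κ₀⁴·klE3Acum R`, `2Zs ≤ 2^11·…` (no door beyond `klEngU₀10 ≤ klE3U₀all`) + C1 `hcut` / C2 `hsp` literal ⇒ `TwoLegStepV17F2 L M klEngGeo8 P Q R β U μ n`;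
* **`stub_twoLeg_step_of_twoLegDualMomentsAt_thr_raise`** — the same with the allowance rows replaced by the generic door `U ≤ klTwoLegMomU R Zt Zs` (the `klC2U` branch);
* **`stub_twoLeg_step_of_momentBounds_pointData_raise`** — the law-agnostic, fully supplier-facing form: raw atom `TwoLegMomentBoundsAt … (K_n) n` + two fit
  lines + per-scale (R)/(D)/budget for C1 and C2 on private rates (VL) + `h0 : FrameOK R U (nScales β) μ 0` (kept as a hypothesis: `klFrameOK_zeroC` lives in
  the route cone) ⇒ `TwoLegStepV17F2 L M klEngGeo8 P Q R β U μ n`.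

Proofs only (one `exact` each over the `_GQJ` doors); no definitions; nothing about the model is asserted; nothing asserts superconductivity.
References: BGM 2006 §2.4 (2.23), (2.36) [cite: BenfattoGiulianiMastropietro2006].
-/

noncomputable section

namespace Summit.HubbardSuperconductivity.HubbardSuperconductivity.Theorems.EngineV8

set_option linter.dupNamespace false -- summit = problem name (single-conjunct summit), D-0017

open Real Finset Set Literature.MathematicalPhysics.QuantumLattice Literature.Probability.LatticeModels GrassmannAlgebra
open Literature.MathematicalPhysics.QuantumLattice.FermiRG Literature.MathematicalPhysics.QuantumLattice.BandSectorCounting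
open Summit.HubbardSuperconductivity.HubbardSuperconductivity.Theorems.KLProgrammeLegKernels
open Summit.HubbardSuperconductivity.HubbardSuperconductivity.Theorems.DispersionFlow
open Summit.HubbardSuperconductivity.HubbardSuperconductivity.Theorems.PerturbedFermiCurve
open Summit.HubbardSuperconductivity.HubbardSuperconductivity.Theorems.KLRegimeSplit
open Summit.HubbardSuperconductivity.HubbardSuperconductivity.Theorems.TwoPointAssembly
open Summit.HubbardSuperconductivity.HubbardSuperconductivity.Theorems.TwoLegFourier

section Raise

/-- The geometry row at `klEngGeo8` for a table dominated by `klEngGeo7.S`. -/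
private theorem hGS8 (cJ : ℕ → ℝ) (hC : ∀ k, cJ k ≤ klEngGeo7.S k) : ∀ k, cJ k ≤ klEngGeo8.S k :=
  fun k => by rw [klEngGeo8_S]; exact hC k

/-- The `S'` row of a raise of `klEngQ7 P R`. -/
private theorem hQS_raise (P : SplitConsts) (R : RenConsts) (Q : EngConsts) (hQ : (klEngQ7 P R).IsRaiseOf Q) :
    ∀ k, klC4aJetC' P R k ≤ Q.S' k := fun k => by rw [hQ.S'_eq]; exact klC4aJetC'_le_klEngQ7_S' P R k

/-- The `CL` row of a raise of `klEngQ7 P R`. -/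
private theorem hQCL_raise (P : SplitConsts) (R : RenConsts) (Q : EngConsts) (hQ : (klEngQ7 P R).IsRaiseOf Q) :
    ∀ (β : ℝ) (n : ℕ), 0 ≤ Q.CL β n := fun β n => by rw [hQ.CL_eq]; exact klEngQ7_CL_nonneg P R β n

variable (P : SplitConsts) (R : RenConsts) (c : ℝ) (Q : EngConsts) (hQ : (klEngQ7 P R).IsRaiseOf Q) (cJ : ℕ → ℝ) (hC : ∀ k, cJ k ≤ klEngGeo7.S k)

include hQ hC

/-- **STUB (e) v2, (e)-HDUAL SHAPE, RAISE-GENERIC, ALLOWANCE FORM**: for any raise `Q` of `klEngQ7 P R`, geometry `klEngGeo8`, doors `klEngC₃6 / klEngU₀10 / klEngL₄ /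
klEngM₃`, table `cJ ≤ klEngGeo7.S`: stub (e)'s binders at `(klEngGeo8, Q)` + `hJ` (stub (C)) + `hdual : TwoLegDualMomentsAt L M Zt Zs β U μ n` + the two allowance rows +
C1/C2 literal ⇒ `TwoLegStepV17F2 L M klEngGeo8 P Q R β U μ n`. -/
theorem stub_twoLeg_step_of_twoLegDualMomentsAt_raise (hP : P.WF) (hR : R.WF2) (hc : 0 < c) (hc3 : c ≤ klEngC₃6 P R)
    (μ : ℝ) (hμ : μ ∈ klWindowC) (U : ℝ) (hU : 0 < U) (hUle : U ≤ klEngU₀10 P R c) (β : ℝ) (hβ : klBetaMin ≤ β)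
    (hβc : β ≤ Real.exp (c / U ^ 2)) (L M : ℕ) [NeZero L] [NeZero M] (hL : klEngL₄ P R β U ≤ L) (hM : klEngM₃ β U L ≤ M)
    (n : ℕ) (hn1 : 1 ≤ n) (hn : n ≤ nScales β + 1) (hreg : IsKLRegime U c (-(n : ℤ)))
    (hhist : HistP klPredsV17F2 L M klEngGeo8 P Q R β U μ 0 n)
    (hfr : FrameOK R U (nScales β) μ (klFlowFrameU L M β U μ n))
    (hE : EngineBoundsAtV17F2 L M klEngGeo8 P Q β U μ n)
    (hJ : TwoLegReadJetBound L M cJ (klC4aJetC' P R) β U μ (klFlowFrameU L M β U μ n) n)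
    {Zt Zs : ℝ} (hdual : TwoLegDualMomentsAt L M Zt Zs β U μ n)
    (hZa : 2 * Zt ≤ (2 : ℝ) ^ 10 * Real.exp 1 ^ 18 * Real.sqrt (2 * (7 + 1606732)) ^ 4 * klE3Acum R)
    (hSa : 2 * Zs ≤ (2 : ℝ) ^ 11 * Real.exp 1 ^ 18 * Real.sqrt (2 * (7 + 1606732)) ^ 4 * klE3Acum R)
    (hcut : ∀ (Mq : ℕ → ℕ) (L₁ M₁ M₂ : ℕ) [NeZero L₁] [NeZero M₁] [NeZero M₂], L ≤ L₁ → Q.M0 β L₁ ≤ M₁ → Mq L₁ ≤ M₁ → M₁ ≤ M₂ →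
      (∀ j < n, histV17F2 L₁ M₁ klEngGeo8 P Q R β U μ j ∧ TwoLegSlopes L₁ M₁ R β U μ (klFlowFrameU L₁ M₁ β U μ j) j) →
      (∀ j < n, histV17F2 L₁ M₂ klEngGeo8 P Q R β U μ j ∧ TwoLegSlopes L₁ M₂ R β U μ (klFlowFrameU L₁ M₂ β U μ j) j) →
        ∀ θ : ℝ, |klLocalPart L₁ M₁ β U μ (klFlowFrameU L₁ M₁ β U μ n) n θ -
          klLocalPart L₁ M₂ β U μ (klFlowFrameU L₁ M₂ β U μ n) n θ| ≤ Q.CL β n / 4 / L₁)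
    (hsp : ∀ (Mq : ℕ → ℕ) (L₁ L₂ M₂ : ℕ) [NeZero L₁] [NeZero L₂] [NeZero M₂], L ≤ L₁ → L₁ ∣ L₂ → Q.M0 β L₁ ≤ M₂ → Mq L₁ ≤ M₂ →
      Q.M0 β L₂ ≤ M₂ → Mq L₂ ≤ M₂ →
      (∀ j < n, histV17F2 L₁ M₂ klEngGeo8 P Q R β U μ j ∧ TwoLegSlopes L₁ M₂ R β U μ (klFlowFrameU L₁ M₂ β U μ j) j) →
      (∀ j < n, histV17F2 L₂ M₂ klEngGeo8 P Q R β U μ j ∧ TwoLegSlopes L₂ M₂ R β U μ (klFlowFrameU L₂ M₂ β U μ j) j) →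
        ∀ θ : ℝ, |klLocalPart L₁ M₂ β U μ (klFlowFrameU L₁ M₂ β U μ n) n θ -
          klLocalPart L₂ M₂ β U μ (klFlowFrameU L₂ M₂ β U μ n) n θ| ≤ Q.CL β n / 4 / L₁) :
    TwoLegStepV17F2 L M klEngGeo8 P Q R β U μ n :=
  stub_twoLeg_step_of_twoLegDualMomentsAt_GQJ klEngGeo8 Q cJ (klC4aJetC' P R) P R c (hGS8 cJ hC) (hQS_raise P R Q hQ)
    (hQCL_raise P R Q hQ) (klEngC₃6_le_klEngC₃3 P R) (klEngU₀10_le_klEngU₀4 P R c) (klEngU₀10_le_klE3U₀all P R c) hP hR hc hc3 μ hμ U hU hUle β hβ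
    hβc L M (klEngL₃_le_of_klEngL₄_le hL) hM n hn1 hn hreg hhist hfr hE hJ hdual hZa hSa hcut hsp

/-- **STUB (e) v2, (e)-HDUAL SHAPE, RAISE-GENERIC, GENERIC-THRESHOLD FORM** (the `klC2U` branch): as above with the allowance rows replaced by the door
`U ≤ klTwoLegMomU R Zt Zs`. -/
theorem stub_twoLeg_step_of_twoLegDualMomentsAt_thr_raise (hP : P.WF) (hR : R.WF2) (hc : 0 < c) (hc3 : c ≤ klEngC₃6 P R)
    (μ : ℝ) (hμ : μ ∈ klWindowC) (U : ℝ) (hU : 0 < U) (hUle : U ≤ klEngU₀10 P R c) {Zt Zs : ℝ} (hUm : U ≤ klTwoLegMomU R Zt Zs) (β : ℝ)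
    (hβ : klBetaMin ≤ β) (hβc : β ≤ Real.exp (c / U ^ 2)) (L M : ℕ) [NeZero L] [NeZero M] (hL : klEngL₄ P R β U ≤ L) (hM : klEngM₃ β U L ≤ M)
    (n : ℕ) (hn1 : 1 ≤ n) (hn : n ≤ nScales β + 1) (hreg : IsKLRegime U c (-(n : ℤ)))
    (hhist : HistP klPredsV17F2 L M klEngGeo8 P Q R β U μ 0 n)
    (hfr : FrameOK R U (nScales β) μ (klFlowFrameU L M β U μ n))
    (hE : EngineBoundsAtV17F2 L M klEngGeo8 P Q β U μ n)
    (hJ : TwoLegReadJetBound L M cJ (klC4aJetC' P R) β U μ (klFlowFrameU L M β U μ n) n)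
    (hdual : TwoLegDualMomentsAt L M Zt Zs β U μ n)
    (hcut : ∀ (Mq : ℕ → ℕ) (L₁ M₁ M₂ : ℕ) [NeZero L₁] [NeZero M₁] [NeZero M₂], L ≤ L₁ → Q.M0 β L₁ ≤ M₁ → Mq L₁ ≤ M₁ → M₁ ≤ M₂ →
      (∀ j < n, histV17F2 L₁ M₁ klEngGeo8 P Q R β U μ j ∧ TwoLegSlopes L₁ M₁ R β U μ (klFlowFrameU L₁ M₁ β U μ j) j) →
      (∀ j < n, histV17F2 L₁ M₂ klEngGeo8 P Q R β U μ j ∧ TwoLegSlopes L₁ M₂ R β U μ (klFlowFrameU L₁ M₂ β U μ j) j) →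
        ∀ θ : ℝ, |klLocalPart L₁ M₁ β U μ (klFlowFrameU L₁ M₁ β U μ n) n θ -
          klLocalPart L₁ M₂ β U μ (klFlowFrameU L₁ M₂ β U μ n) n θ| ≤ Q.CL β n / 4 / L₁)
    (hsp : ∀ (Mq : ℕ → ℕ) (L₁ L₂ M₂ : ℕ) [NeZero L₁] [NeZero L₂] [NeZero M₂], L ≤ L₁ → L₁ ∣ L₂ → Q.M0 β L₁ ≤ M₂ → Mq L₁ ≤ M₂ →
      Q.M0 β L₂ ≤ M₂ → Mq L₂ ≤ M₂ →
      (∀ j < n, histV17F2 L₁ M₂ klEngGeo8 P Q R β U μ j ∧ TwoLegSlopes L₁ M₂ R β U μ (klFlowFrameU L₁ M₂ β U μ j) j) →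
      (∀ j < n, histV17F2 L₂ M₂ klEngGeo8 P Q R β U μ j ∧ TwoLegSlopes L₂ M₂ R β U μ (klFlowFrameU L₂ M₂ β U μ j) j) →
        ∀ θ : ℝ, |klLocalPart L₁ M₂ β U μ (klFlowFrameU L₁ M₂ β U μ n) n θ -
          klLocalPart L₂ M₂ β U μ (klFlowFrameU L₂ M₂ β U μ n) n θ| ≤ Q.CL β n / 4 / L₁) :
    TwoLegStepV17F2 L M klEngGeo8 P Q R β U μ n :=
  stub_twoLeg_step_of_twoLegDualMomentsAt_thr_GQJ klEngGeo8 Q cJ (klC4aJetC' P R) P R c (U₀c := min (klEngU₀10 P R c) (klTwoLegMomU R Zt Zs))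
    (hGS8 cJ hC) (hQS_raise P R Q hQ) (hQCL_raise P R Q hQ) (klEngC₃6_le_klEngC₃3 P R)
    ((min_le_left _ _).trans (klEngU₀10_le_klEngU₀4 P R c)) (min_le_right _ _) hP hR hc hc3 μ hμ U hU (le_min hUle hUm) β hβ hβc L M
    (klEngL₃_le_of_klEngL₄_le hL) hM n hn1 hn hreg hhist hfr hE hJ hdual hcut hsp

/-- **STUB (e) v2, SUPPLIER-FACING, RAISE-GENERIC** (law-agnostic): for any raise `Q` of `klEngQ7 P R`, geometry `klEngGeo8`, the LANDED doors, table `cJ ≤ klEngGeo7.S`: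
stub (e)'s binders + `hJ` (stub (C)) + the raw two-leg moment atom at `(K_n, n)` with its two fit lines (class #7, any law) + per-scale (R)/(D)/budget for the
cutoff and the spatial nested legs on private rates (VL lanes) + the bare frame `h0` ⇒ `TwoLegStepV17F2 L M klEngGeo8 P Q R β U μ n`. -/
theorem stub_twoLeg_step_of_momentBounds_pointData_raise (hP : P.WF) (hR : R.WF2) (hc : 0 < c) (hc3 : c ≤ klEngC₃6 P R)
    (μ : ℝ) (hμ : μ ∈ klWindowC) (U : ℝ) (hU : 0 < U) (hUle : U ≤ klEngU₀10 P R c) (β : ℝ) (hβ : klBetaMin ≤ β)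
    (hβc : β ≤ Real.exp (c / U ^ 2)) (L M : ℕ) [NeZero L] [NeZero M] (hL : klEngL₄ P R β U ≤ L) (hM : klEngM₃ β U L ≤ M)
    (n : ℕ) (hn1 : 1 ≤ n) (hn : n ≤ nScales β + 1) (hreg : IsKLRegime U c (-(n : ℤ)))
    (hhist : HistP klPredsV17F2 L M klEngGeo8 P Q R β U μ 0 n)
    (hfr : FrameOK R U (nScales β) μ (klFlowFrameU L M β U μ n))
    (hE : EngineBoundsAtV17F2 L M klEngGeo8 P Q β U μ n)
    (hJ : TwoLegReadJetBound L M cJ (klC4aJetC' P R) β U μ (klFlowFrameU L M β U μ n) n)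
    {Mt Ms : ℝ} (hD : TwoLegMomentBoundsAt L M Mt Ms β U μ (klFlowFrameU L M β U μ n) n)
    (hzfit : 2 * Mt ≤ R.cz * |U|) (hsfit : 2 * Ms + 4 / 3 * R.Gfr 1 * U ^ 2 ≤ R.cz * |U| * (cDtmin (-1.2) (-0.05) / 2))
    (h0 : FrameOK R U (nScales β) μ 0) {a₁ b₁ d₁ a₂ b₂ d₂ : ℕ → ℝ}
    (ha₁ : ∀ m ≤ n, a₁ m ≤ Q.CL β m / 4) (hb₁ : ∀ m ≤ n, 0 ≤ b₁ m)
    (hgrad₁ : ∀ m ≤ n, ∀ (Mq : ℕ → ℕ) (L₁ M₁ M₂ : ℕ) [NeZero L₁] [NeZero M₁] [NeZero M₂], L ≤ L₁ → Q.M0 β L₁ ≤ M₁ → Mq L₁ ≤ M₁ →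
      M₁ ≤ M₂ →
      (∀ j < m, histV17F2 L₁ M₁ klEngGeo8 P Q R β U μ j ∧ TwoLegSlopes L₁ M₁ R β U μ (klFlowFrameU L₁ M₁ β U μ j) j) →
      (∀ j < m, histV17F2 L₁ M₂ klEngGeo8 P Q R β U μ j ∧ TwoLegSlopes L₁ M₂ R β U μ (klFlowFrameU L₁ M₂ β U μ j) j) →
      (∀ j < m, ∀ θ : ℝ, |klLocalPart L₁ M₁ β U μ (klFlowFrameU L₁ M₁ β U μ j) j θ -
        klLocalPart L₁ M₂ β U μ (klFlowFrameU L₁ M₂ β U μ j) j θ| ≤ a₁ j / L₁) →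
      (∀ q : Fin 2 → ℝ, |(klFlowFrameU L₁ M₁ β U μ m).eval q - (klFlowFrameU L₁ M₂ β U μ m).eval q| ≤ (∑ j ∈ range m, a₁ j) / L₁) →
        ∀ q : Momentum, |frameLevel μ (klFlowFrameU L₁ M₁ β U μ m) q| ≤ (∑ j ∈ range m, a₁ j) / L₁ →
          ‖fderiv ℝ (evalM (symInterp L₁ (klLocSelfEnergyRe L₁ M₁ β U μ (klFlowFrameU L₁ M₁ β U μ m) m))) q‖ ≤ b₁ m)
    (hD₁ : ∀ m ≤ n, ∀ (Mq : ℕ → ℕ) (L₁ M₁ M₂ : ℕ) [NeZero L₁] [NeZero M₁] [NeZero M₂], L ≤ L₁ → Q.M0 β L₁ ≤ M₁ → Mq L₁ ≤ M₁ →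
      M₁ ≤ M₂ →
      (∀ j < m, histV17F2 L₁ M₁ klEngGeo8 P Q R β U μ j ∧ TwoLegSlopes L₁ M₁ R β U μ (klFlowFrameU L₁ M₁ β U μ j) j) →
      (∀ j < m, histV17F2 L₁ M₂ klEngGeo8 P Q R β U μ j ∧ TwoLegSlopes L₁ M₂ R β U μ (klFlowFrameU L₁ M₂ β U μ j) j) →
      (∀ j < m, ∀ θ : ℝ, |klLocalPart L₁ M₁ β U μ (klFlowFrameU L₁ M₁ β U μ j) j θ -
        klLocalPart L₁ M₂ β U μ (klFlowFrameU L₁ M₂ β U μ j) j θ| ≤ a₁ j / L₁) →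
      (∀ q : Fin 2 → ℝ, |(klFlowFrameU L₁ M₁ β U μ m).eval q - (klFlowFrameU L₁ M₂ β U μ m).eval q| ≤ (∑ j ∈ range m, a₁ j) / L₁) →
        ∀ θ : ℝ, |(symInterp L₁ (klLocSelfEnergyRe L₁ M₁ β U μ (klFlowFrameU L₁ M₁ β U μ m) m)).eval
              (klFermiPoint μ (klFlowFrameU L₁ M₂ β U μ m) θ) -
            (symInterp L₁ (klLocSelfEnergyRe L₁ M₂ β U μ (klFlowFrameU L₁ M₂ β U μ m) m)).eval
              (klFermiPoint μ (klFlowFrameU L₁ M₂ β U μ m) θ)| ≤ d₁ m / L₁)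
    (hbudget₁ : ∀ m ≤ n, b₁ m * (∑ j ∈ range m, a₁ j) / klCurveD + d₁ m ≤ a₁ m)
    (ha₂ : ∀ m ≤ n, a₂ m ≤ Q.CL β m / 4) (hb₂ : ∀ m ≤ n, 0 ≤ b₂ m)
    (hgrad₂ : ∀ m ≤ n, ∀ (Mq : ℕ → ℕ) (L₁ L₂ M₂ : ℕ) [NeZero L₁] [NeZero L₂] [NeZero M₂], L ≤ L₁ → L₁ ∣ L₂ → Q.M0 β L₁ ≤ M₂ →
      Mq L₁ ≤ M₂ → Q.M0 β L₂ ≤ M₂ → Mq L₂ ≤ M₂ →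
      (∀ j < m, histV17F2 L₁ M₂ klEngGeo8 P Q R β U μ j ∧ TwoLegSlopes L₁ M₂ R β U μ (klFlowFrameU L₁ M₂ β U μ j) j) →
      (∀ j < m, histV17F2 L₂ M₂ klEngGeo8 P Q R β U μ j ∧ TwoLegSlopes L₂ M₂ R β U μ (klFlowFrameU L₂ M₂ β U μ j) j) →
      (∀ j < m, ∀ θ : ℝ, |klLocalPart L₁ M₂ β U μ (klFlowFrameU L₁ M₂ β U μ j) j θ -
        klLocalPart L₂ M₂ β U μ (klFlowFrameU L₂ M₂ β U μ j) j θ| ≤ a₂ j / L₁) →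
      (∀ q : Fin 2 → ℝ, |(klFlowFrameU L₁ M₂ β U μ m).eval q - (klFlowFrameU L₂ M₂ β U μ m).eval q| ≤ (∑ j ∈ range m, a₂ j) / L₁) →
        ∀ q : Momentum, |frameLevel μ (klFlowFrameU L₁ M₂ β U μ m) q| ≤ (∑ j ∈ range m, a₂ j) / L₁ →
          ‖fderiv ℝ (evalM (symInterp L₁ (klLocSelfEnergyRe L₁ M₂ β U μ (klFlowFrameU L₁ M₂ β U μ m) m))) q‖ ≤ b₂ m)
    (hD₂ : ∀ m ≤ n, ∀ (Mq : ℕ → ℕ) (L₁ L₂ M₂ : ℕ) [NeZero L₁] [NeZero L₂] [NeZero M₂], L ≤ L₁ → L₁ ∣ L₂ → Q.M0 β L₁ ≤ M₂ →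
      Mq L₁ ≤ M₂ → Q.M0 β L₂ ≤ M₂ → Mq L₂ ≤ M₂ →
      (∀ j < m, histV17F2 L₁ M₂ klEngGeo8 P Q R β U μ j ∧ TwoLegSlopes L₁ M₂ R β U μ (klFlowFrameU L₁ M₂ β U μ j) j) →
      (∀ j < m, histV17F2 L₂ M₂ klEngGeo8 P Q R β U μ j ∧ TwoLegSlopes L₂ M₂ R β U μ (klFlowFrameU L₂ M₂ β U μ j) j) →
      (∀ j < m, ∀ θ : ℝ, |klLocalPart L₁ M₂ β U μ (klFlowFrameU L₁ M₂ β U μ j) j θ -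
        klLocalPart L₂ M₂ β U μ (klFlowFrameU L₂ M₂ β U μ j) j θ| ≤ a₂ j / L₁) →
      (∀ q : Fin 2 → ℝ, |(klFlowFrameU L₁ M₂ β U μ m).eval q - (klFlowFrameU L₂ M₂ β U μ m).eval q| ≤ (∑ j ∈ range m, a₂ j) / L₁) →
        ∀ θ : ℝ, |(symInterp L₁ (klLocSelfEnergyRe L₁ M₂ β U μ (klFlowFrameU L₁ M₂ β U μ m) m)).eval
              (klFermiPoint μ (klFlowFrameU L₂ M₂ β U μ m) θ) -
            (symInterp L₂ (klLocSelfEnergyRe L₂ M₂ β U μ (klFlowFrameU L₂ M₂ β U μ m) m)).eval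
              (klFermiPoint μ (klFlowFrameU L₂ M₂ β U μ m) θ)| ≤ d₂ m / L₁)
    (hbudget₂ : ∀ m ≤ n, b₂ m * (∑ j ∈ range m, a₂ j) / klCurveD + d₂ m ≤ a₂ m) :
    TwoLegStepV17F2 L M klEngGeo8 P Q R β U μ n :=
  stub_twoLeg_step_of_momentBounds_pointData_GQJ klEngGeo8 Q cJ (klC4aJetC' P R) P R c (hGS8 cJ hC) (hQS_raise P R Q hQ)
    (hQCL_raise P R Q hQ) (klEngC₃6_le_klEngC₃3 P R) (klEngU₀10_le_klEngU₀4 P R c) hP hR hc hc3 μ hμ U hU hUle β hβ hβc L M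
    (klEngL₃_le_of_klEngL₄_le hL) hM n hn1 hn hreg hhist hfr hE hJ hD hzfit hsfit h0 ha₁ hb₁ hgrad₁ hD₁ hbudget₁ ha₂ hb₂ hgrad₂ hD₂ hbudget₂

end Raise

end Summit.HubbardSuperconductivity.HubbardSuperconductivity.Theorems.EngineV8

end
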